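import Literature.MathematicalPhysics.QuantumFieldTheory.SUNBakryEmeryDeBruijn
import HarnessLib

/-!
# The `Γ₂` step: derivative of the Fisher information along the heat flow on `SU(N)`

Third file of the dynamic Bakry–Émery argument for the Haar measure `σ` of `SU(N)` (Bakry–Gentil–Ledoux 2014, §5.7,
p. 268–269).  For a smooth ambient `p` with `p ≥ δ > 0` on `SU(N)` write `I(p) = ∫ Γ(p,p)/p dσ` (Fisher information)
and `q = log p` (realised as a globally smooth `ψ∘p`, `exists_smooth_log_cutoff`).  We prove

* ★ `integral_fisherDeriv_le` — the **integrated `Γ₂` inequality**: the time-derivative integrand of `I(p_t)` under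
  `∂_t p = Δp`, namely `(2Γ(p,Δp)p − Γ(p,p)Δp)/p²`, integrates to `−2∫ p Γ₂(q) dσ` (BGL p. 269:
  `Λ'' = 2∫ P_t f Γ₂(log P_t f) dμ`), which by the curvature bound `Γ₂ ≥ (N/2)Γ` on `SU(N)`
  (`Gam2_potential_ge`, `Ric = N/2`) is `≤ −N·I(p)`;
* ★ `hasDerivAt_fisher_flow` — along a polynomial heat flow `p_t = ∑ c_i(t) b_i` (`Δp_t = ∂_t p_t`) which is
  `≥ δ > 0` on `SU(N)` near `t₀`, `t ↦ I(p_t)` is differentiable at `t₀` with derivative that integral; hence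
  `I'(t₀) ≤ −N·I(p_{t₀})` (`hasDerivAt_fisher_flow_le`), the differential form of BGL (5.7.2)/(5.7.4)
  `I(P_t f) ≤ e^{−2ρt} I(f)` with `ρ = N/2`.

Theorems only; no definition.  The log-Sobolev inequality itself is assembled in the sequel.

## References

* D. Bakry, I. Gentil, M. Ledoux, *Analysis and Geometry of Markov Diffusion Operators*, Grundlehren 348 (2014), §5.7,
  p. 268–269, (5.7.2)–(5.7.4); Prop. 5.7.3.
* H. Shen, R. Zhu, X. Zhu, CMP 400 (2023) 805–851, (4.7)–(4.8) (`Ric = N/2` on `SU(N)`).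
-/

noncomputable section

open scoped Matrix ComplexConjugate BigOperators

namespace Literature.MathematicalPhysics.QuantumFieldTheory

namespace SUNBakryEmery

open scoped Matrix.Norms.Frobenius ContDiff Topology
open Matrix Complex Finset MeasureTheory Filter Set Metric

variable {N : ℕ}

/-! ### The integrated `Γ₂` inequality -/

/-- ★ **The `Γ₂` step of the Bakry–Émery argument on `SU(N)`** (BGL §5.7 p. 269: `Λ''(t) = 2∫ P_t f Γ₂(log P_t f) dμ`
combined with `CD(ρ,∞)`, `ρ = N/2` on `SU(N)`): for a smooth ambient `p` with `p ≥ δ > 0` on `SU(N)`,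
`∫ (2Γ(p,Δp)·p − Γ(p,p)·Δp)/p² dσ ≤ −N ∫ Γ(p,p)/p dσ`.
Proof: with `q = ψ∘p`, `ψ = log` near the range of `p`, both `∫ (2Γ(p,Δp)p − Γ(p,p)Δp)/p² dσ` and `−2∫ p Γ₂(q) dσ` equal
`−2∫ (Δp)²/p + ∫ Δp·Γ(p,p)/p²` (integration by parts `∫ FΔG = −∫Γ(F,G)` and the chain rules
`Γ(q,·) = Γ(p,·)/p`, `Δq = Δp/p − Γ(p,p)/p²`), and `Γ₂(q) ≥ (N/2)Γ(q,q) = (N/2)Γ(p,p)/p²` pointwise on `SU(N)`.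
[cite: BakryGentilLedoux2014, §5.7 (5.7.2) (p. 269)] -/
theorem integral_fisherDeriv_le (hN : N ≠ 0) {p : Matrix (Fin N) (Fin N) ℂ → ℝ} (hp : ContDiff ℝ ∞ p)
    {δ : ℝ} (hδ : 0 < δ) (hpos : ∀ g : SUN N, δ ≤ p g) :
    ∫ g : SUN N, (2 * Gam p (Lap p) g * p g - Gam p p g * Lap p g) / (p g) ^ 2 ∂(haarSU N) ≤
      -(N : ℝ) * ∫ g : SUN N, Gam p p g / p g ∂(haarSU N) := by
  set σ := haarSU N
  obtain ⟨ψ, hψ, hψp⟩ := exists_smooth_log_cutoff (a := δ / 4) (by linarith)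
  have hpg : ∀ g : SUN N, 2 * (δ / 4) < p g := fun g => by linarith [hpos g]
  have hp0 : ∀ g : SUN N, p g ≠ 0 := fun g => ne_of_gt (lt_of_lt_of_le hδ (hpos g))
  have hψ1 : ∀ g : SUN N, deriv ψ (p g) = (p g)⁻¹ := fun g => (hψp _ (hpg g)).2.1
  have hψ2 : ∀ g : SUN N, deriv (deriv ψ) (p g) = -((p g) ^ 2)⁻¹ := fun g => (hψp _ (hpg g)).2.2
  set q : Matrix (Fin N) (Fin N) ℂ → ℝ := fun Q => ψ (p Q) with hq_def
  have hq : ContDiff ℝ ∞ q := hψ.comp hp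
  -- continuity on `SU(N)` of everything in sight
  have hpc : Continuous fun g : SUN N => p g := continuous_restrict hp
  have hLc : Continuous fun g : SUN N => Lap p g := continuous_restrict (contDiff_Lap hp)
  have hGc : Continuous fun g : SUN N => Gam p p g := continuous_restrict (contDiff_Gam hp hp)
  have hGLc : Continuous fun g : SUN N => Gam p (Lap p) g := continuous_restrict (contDiff_Gam hp (contDiff_Lap hp))
  have hI : ∀ {φ : SUN N → ℝ}, Continuous φ → Integrable φ σ := fun h => integrable_of_continuous_SUN h _
  -- pointwise chain rules on `SU(N)`
  have hGq : ∀ g : SUN N, Gam q (Lap p) g = Gam p (Lap p) g / p g := fun g => by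
    rw [hq_def, Gam_comp_left hp hψ, hψ1, inv_mul_eq_div]
  have hGqLq : ∀ g : SUN N, Gam q (Lap q) g = Gam p (Lap q) g / p g := fun g => by
    rw [show Gam q (Lap q) g = Gam (fun Q => ψ (p Q)) (Lap q) g from rfl, Gam_comp_left hp hψ, hψ1, inv_mul_eq_div]
  have hGqq : ∀ g : SUN N, Gam q q g = Gam p p g / (p g) ^ 2 := fun g => by
    have e1 : Gam q q g = deriv ψ (p g) * Gam p q g := Gam_comp_left hp hψ (G := q) g
    have e2 : Gam p q g = Gam q p g := by rw [Gam_comm]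
    have e3 : Gam q p g = deriv ψ (p g) * Gam p p g := Gam_comp_left hp hψ (G := p) g
    rw [e1, e2, e3, hψ1]
    simp only [div_eq_mul_inv]
    ring
  have hLq : ∀ g : SUN N, Lap q g = Lap p g / p g - Gam p p g / (p g) ^ 2 := fun g => by
    rw [hq_def, Lap_comp hp hψ, hψ1, hψ2]
    simp only [div_eq_mul_inv]
    ring
  -- the curvature bound `Γ₂(q) ≥ (N/2) Γ(q,q)` on `SU(N)`
  have hCD : ∀ g : SUN N, (N : ℝ) / 2 * Gam q q g ≤ (1 / 2) * Lap (Gam q q) g - Gam q (Lap q) g := by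
    intro g
    have h := Gam2_potential_ge hN 0 0 hq (SUN.mem_unitaryGroup g)
    have e : (fun Q : Matrix (Fin N) (Fin N) ℂ => (0 : ℝ) * (Q * 0).trace.re) = fun _ => 0 := by funext Q; simp
    rw [e] at h
    simp only [abs_zero, zero_mul, sub_zero, Gam2, genL_const] at h
    exact h
  -- integrability of the basic integrands
  have iA : Integrable (fun g : SUN N => Lap p g ^ 2 / p g) σ := hI ((hLc.pow 2).div hpc hp0)
  have iB : Integrable (fun g : SUN N => Lap p g * Gam p p g / (p g) ^ 2) σ :=
    hI ((hLc.mul hGc).div (hpc.pow 2) fun g => pow_ne_zero 2 (hp0 g))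
  have iC : Integrable (fun g : SUN N => Gam p (Lap p) g / p g) σ := hI (hGLc.div hpc hp0)
  -- three basic integrals
  set A := ∫ g : SUN N, Lap p g ^ 2 / p g ∂σ with hA
  set B := ∫ g : SUN N, Lap p g * Gam p p g / (p g) ^ 2 ∂σ with hB
  -- (i) `∫ Γ(p,Δp)/p = −A + B`
  have hi : ∫ g : SUN N, Gam p (Lap p) g / p g ∂σ = -A + B := by
    have h1 : ∫ g : SUN N, Gam p (Lap p) g / p g ∂σ = ∫ g : SUN N, Gam (Lap p) q g ∂σ := by
      refine integral_congr_ae (ae_of_all _ fun g => ?_)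
      dsimp only
      rw [Gam_comm (Lap p) q, hGq]
    have h2 : ∫ g : SUN N, Lap p g * Lap q g ∂σ = -∫ g : SUN N, Gam (Lap p) q g ∂σ :=
      integral_mul_Lap hN (contDiff_Lap hp) hq
    have h3 : ∫ g : SUN N, Lap p g * Lap q g ∂σ = A - B := by
      rw [hA, hB, ← integral_sub iA iB]
      refine integral_congr_ae (ae_of_all _ fun g => ?_)
      dsimp only
      rw [hLq]
      simp only [div_eq_mul_inv]
      ring
    rw [h1]
    linarith
  -- (ii) the left-hand side equals `−2A + B`
  have hii : ∫ g : SUN N, (2 * Gam p (Lap p) g * p g - Gam p p g * Lap p g) / (p g) ^ 2 ∂σ = -2 * A + B := by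
    have e : ∀ g : SUN N, (2 * Gam p (Lap p) g * p g - Gam p p g * Lap p g) / (p g) ^ 2 =
        2 * (Gam p (Lap p) g / p g) - Lap p g * Gam p p g / (p g) ^ 2 := fun g => by
      have h0 := hp0 g
      field_simp
    simp_rw [e]
    rw [integral_sub (iC.const_mul 2) iB, integral_const_mul, hi, ← hB]
    ring
  -- (iii) `−2∫ p Γ₂(q) = −2A + B`
  have hT1 : ∫ g : SUN N, p g * Lap (Gam q q) g ∂σ = B := by
    have h1 : ∫ g : SUN N, p g * Lap (Gam q q) g ∂σ = -∫ g : SUN N, Gam p (Gam q q) g ∂σ :=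
      integral_mul_Lap hN hp (contDiff_Gam hq hq)
    have h2 : ∫ g : SUN N, Gam q q g * Lap p g ∂σ = -∫ g : SUN N, Gam (Gam q q) p g ∂σ :=
      integral_mul_Lap hN (contDiff_Gam hq hq) hp
    have h3 : ∫ g : SUN N, Gam (Gam q q) p g ∂σ = ∫ g : SUN N, Gam p (Gam q q) g ∂σ := by
      refine integral_congr_ae (ae_of_all _ fun g => ?_); dsimp only; rw [Gam_comm]
    have h4 : ∫ g : SUN N, Gam q q g * Lap p g ∂σ = B := by
      rw [hB]; refine integral_congr_ae (ae_of_all _ fun g => ?_)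
      dsimp only
      rw [hGqq]
      simp only [div_eq_mul_inv]
      ring
    linarith
  have hT2 : ∫ g : SUN N, p g * Gam q (Lap q) g ∂σ = -A + B := by
    have h1 : ∫ g : SUN N, p g * Gam q (Lap q) g ∂σ = ∫ g : SUN N, Gam (Lap q) p g ∂σ := by
      refine integral_congr_ae (ae_of_all _ fun g => ?_)
      dsimp only
      rw [hGqLq, Gam_comm (Lap q) p, mul_div_assoc', mul_div_cancel_left₀ _ (hp0 g)]
    have h2 : ∫ g : SUN N, Lap q g * Lap p g ∂σ = -∫ g : SUN N, Gam (Lap q) p g ∂σ :=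
      integral_mul_Lap hN (contDiff_Lap hq) hp
    have h3 : ∫ g : SUN N, Lap q g * Lap p g ∂σ = A - B := by
      rw [hA, hB, ← integral_sub iA iB]
      refine integral_congr_ae (ae_of_all _ fun g => ?_)
      dsimp only
      rw [hLq]
      simp only [div_eq_mul_inv]
      ring
    linarith
  have hqc : Continuous fun g : SUN N => Gam q q g := continuous_restrict (contDiff_Gam hq hq)
  have hLGqc : Continuous fun g : SUN N => Lap (Gam q q) g := continuous_restrict (contDiff_Lap (contDiff_Gam hq hq))
  have hGqLqc : Continuous fun g : SUN N => Gam q (Lap q) g := continuous_restrict (contDiff_Gam hq (contDiff_Lap hq))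
  have hiii : -2 * ∫ g : SUN N, p g * ((1 / 2) * Lap (Gam q q) g - Gam q (Lap q) g) ∂σ = -2 * A + B := by
    have e : ∀ g : SUN N, p g * ((1 / 2) * Lap (Gam q q) g - Gam q (Lap q) g) =
        (1 / 2) * (p g * Lap (Gam q q) g) - p g * Gam q (Lap q) g := fun g => by ring
    simp_rw [e]
    have i1 : Integrable (fun g : SUN N => p g * Lap (Gam q q) g) σ := hI (hpc.mul hLGqc)
    have i2 : Integrable (fun g : SUN N => p g * Gam q (Lap q) g) σ := hI (hpc.mul hGqLqc)
    rw [integral_sub (i1.const_mul _) i2, integral_const_mul, hT1, hT2]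
    ring
  -- (iv) the curvature bound integrated against `p > 0`
  have hiv : ∫ g : SUN N, p g * ((N : ℝ) / 2 * Gam q q g) ∂σ ≤
      ∫ g : SUN N, p g * ((1 / 2) * Lap (Gam q q) g - Gam q (Lap q) g) ∂σ := by
    have i1 : Integrable (fun g : SUN N => p g * ((N : ℝ) / 2 * Gam q q g)) σ := hI (hpc.mul (hqc.const_mul _))
    have i2 : Integrable (fun g : SUN N => p g * ((1 / 2) * Lap (Gam q q) g - Gam q (Lap q) g)) σ :=
      hI (hpc.mul ((hLGqc.const_mul _).sub hGqLqc))
    refine integral_mono i1 i2 fun g => ?_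
    exact mul_le_mul_of_nonneg_left (hCD g) (le_of_lt (lt_of_lt_of_le hδ (hpos g)))
  have hv : ∫ g : SUN N, p g * ((N : ℝ) / 2 * Gam q q g) ∂σ = (N : ℝ) / 2 * ∫ g : SUN N, Gam p p g / p g ∂σ := by
    rw [← integral_const_mul]
    refine integral_congr_ae (ae_of_all _ fun g => ?_)
    dsimp only
    rw [hGqq, div_eq_mul_inv, div_eq_mul_inv, pow_two, mul_inv]
    field_simp
  rw [hii, ← hiii]
  nlinarith [hiv, hv]

/-! ### Along a polynomial heat flow -/

/-- ★ **Derivative of the Fisher information along a polynomial heat flow.**  Let `p_t = ∑ c_i(t) b_i` (smooth ambient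
`b_i`, differentiable `c_i` with continuous `c_i'`) solve `Δp_t = ∑ c_i' b_i = ∂_t p_t` and satisfy `p_t ≥ δ > 0` on
`SU(N)` for `t ∈ [t₀−ε, t₀+ε]`.  Then `t ↦ I(p_t) = ∫ Γ(p_t,p_t)/p_t dσ` is differentiable at `t₀` with derivative
`∫ (2Γ(p,Δp)p − Γ(p,p)Δp)/p² dσ` at `p = p_{t₀}` (quotient rule under the integral sign; BGL p. 269, `Λ''`).
[cite: BakryGentilLedoux2014, §5.7 p. 269 (Λ'' along the semigroup)] -/
theorem hasDerivAt_fisher_flow {d : ℕ} {b : Fin d → Matrix (Fin N) (Fin N) ℂ → ℝ}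
    (hb : ∀ i, ContDiff ℝ ∞ (b i)) {c c' : ℝ → Fin d → ℝ} (hc : ∀ t i, HasDerivAt (fun s => c s i) (c' t i) t)
    (hc' : ∀ i, Continuous fun t => c' t i)
    (hheat : ∀ t, Lap (fun Q => ∑ i, c t i * b i Q) = fun Q => ∑ i, c' t i * b i Q)
    {δ t₀ ε : ℝ} (hδ : 0 < δ) (hε : 0 < ε)
    (hpos : ∀ t ∈ Icc (t₀ - ε) (t₀ + ε), ∀ g : SUN N, δ ≤ ∑ i, c t i * b i (g : Matrix (Fin N) (Fin N) ℂ)) :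
    HasDerivAt (fun t => ∫ g : SUN N, Gam (fun Q => ∑ i, c t i * b i Q) (fun Q => ∑ i, c t i * b i Q) g /
        (∑ i, c t i * b i (g : Matrix (Fin N) (Fin N) ℂ)) ∂(haarSU N))
      (∫ g : SUN N, (2 * Gam (fun Q => ∑ i, c t₀ i * b i Q) (Lap (fun Q => ∑ i, c t₀ i * b i Q)) g *
          (∑ i, c t₀ i * b i (g : Matrix (Fin N) (Fin N) ℂ)) -
          Gam (fun Q => ∑ i, c t₀ i * b i Q) (fun Q => ∑ i, c t₀ i * b i Q) g *
            Lap (fun Q => ∑ i, c t₀ i * b i Q) g) /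
        (∑ i, c t₀ i * b i (g : Matrix (Fin N) (Fin N) ℂ)) ^ 2 ∂(haarSU N)) t₀ := by
  -- notation: values, time derivative, gradients in coordinates
  set P : ℝ → SUN N → ℝ := fun t g => ∑ i, c t i * b i (g : Matrix (Fin N) (Fin N) ℂ) with hP
  set LP : ℝ → SUN N → ℝ := fun t g => ∑ i, c' t i * b i (g : Matrix (Fin N) (Fin N) ℂ) with hLP
  set dP : ℝ → FrameIdx N → SUN N → ℝ :=
    fun t α g => ∑ i, c t i * matD (frame α) (b i) (g : Matrix (Fin N) (Fin N) ℂ) with hdP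
  set dLP : ℝ → FrameIdx N → SUN N → ℝ :=
    fun t α g => ∑ i, c' t i * matD (frame α) (b i) (g : Matrix (Fin N) (Fin N) ℂ) with hdLP
  have hcc : ∀ i, Continuous fun t => c t i := continuous_coeff_of_hasDerivAt hc
  have hbc : ∀ i, Continuous fun g : SUN N => b i (g : Matrix (Fin N) (Fin N) ℂ) :=
    fun i => continuous_restrict (hb i)
  have hdbc : ∀ α i, Continuous fun g : SUN N => matD (frame α) (b i) (g : Matrix (Fin N) (Fin N) ℂ) :=
    fun α i => continuous_restrict (contDiff_matD (hb i) _)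
  have hPc : Continuous (Function.uncurry P) := continuous_sum_mul_uncurry hcc hbc
  have hLPc : Continuous (Function.uncurry LP) := continuous_sum_mul_uncurry hc' hbc
  have hdPc : ∀ α, Continuous (Function.uncurry (dP · α ·)) := fun α => continuous_sum_mul_uncurry hcc (hdbc α)
  have hdLPc : ∀ α, Continuous (Function.uncurry (dLP · α ·)) := fun α => continuous_sum_mul_uncurry hc' (hdbc α)
  -- the carré du champ of the flow in coordinates
  have hGam : ∀ t (g : SUN N), Gam (fun Q => ∑ i, c t i * b i Q) (fun Q => ∑ i, c t i * b i Q) g =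
      ∑ α, dP t α g * dP t α g := by
    intro t g
    simp only [Gam, matD_sum_mul hb, hdP]
  have hGamL : ∀ t (g : SUN N), Gam (fun Q => ∑ i, c t i * b i Q) (fun Q => ∑ i, c' t i * b i Q) g =
      ∑ α, dP t α g * dLP t α g := by
    intro t g
    simp only [Gam, matD_sum_mul hb, hdP, hdLP]
  set G : ℝ → SUN N → ℝ := fun t g => ∑ α, dP t α g * dP t α g with hG
  set Gx : ℝ → SUN N → ℝ := fun t g => ∑ α, dP t α g * dLP t α g with hGx
  have hGc : Continuous (Function.uncurry G) :=
    continuous_finsetSum _ fun α _ => (hdPc α).mul (hdPc α)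
  have hGxc : Continuous (Function.uncurry Gx) :=
    continuous_finsetSum _ fun α _ => (hdPc α).mul (hdLPc α)
  -- differentiate under the integral sign
  have hmain := hasDerivAt_integral_SUN (N := N) (t₀ := t₀) hε (F := fun t g => G t g / P t g)
    (F' := fun t g => (2 * Gx t g * P t g - G t g * LP t g) / (P t g) ^ 2) ?_ ?_ ?_
  rotate_left
  · intro t ht
    refine (hGc.comp (Continuous.prodMk_right t)).div (hPc.comp (Continuous.prodMk_right t)) fun g => ?_
    exact ne_of_gt (lt_of_lt_of_le hδ (hpos t ht g))
  · refine ContinuousOn.div ?_ ((hPc.pow 2).continuousOn) fun z hz => ?_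
    · exact ((((hGxc.const_mul 2).mul hPc).sub (hGc.mul hLPc))).continuousOn
    · exact pow_ne_zero 2 (ne_of_gt (lt_of_lt_of_le hδ (hpos z.1 (mem_prod.1 hz).1 z.2)))
  · intro t ht g
    have hne : P t g ≠ 0 := ne_of_gt (lt_of_lt_of_le hδ (hpos t ht g))
    have h1 : HasDerivAt (fun s => P s g) (LP t g) t := hasDerivAt_flow_apply b hc t (g : Matrix (Fin N) (Fin N) ℂ)
    have h2 : HasDerivAt (fun s => G s g) (2 * Gx t g) t := by
      have h := hasDerivAt_gam_flow hb hc t (g : Matrix (Fin N) (Fin N) ℂ)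
      rw [hGamL t g] at h
      have e : (fun s => Gam (fun Q => ∑ i, c s i * b i Q) (fun Q => ∑ i, c s i * b i Q)
          (g : Matrix (Fin N) (Fin N) ℂ)) = fun s => G s g := by
        funext s; rw [hGam s g]
      rw [e] at h
      exact h
    have h3 := h2.div h1 hne
    exact h3
  -- rewrite integrand and value in the announced form
  have eF : (fun t => ∫ g : SUN N, Gam (fun Q => ∑ i, c t i * b i Q) (fun Q => ∑ i, c t i * b i Q) g /
      (∑ i, c t i * b i (g : Matrix (Fin N) (Fin N) ℂ)) ∂(haarSU N)) = fun t => ∫ g : SUN N, G t g / P t g ∂(haarSU N) := by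
    funext t
    refine integral_congr_ae (ae_of_all _ fun g => ?_)
    dsimp only
    rw [hGam t g]
  have eV : ∫ g : SUN N, (2 * Gam (fun Q => ∑ i, c t₀ i * b i Q) (Lap (fun Q => ∑ i, c t₀ i * b i Q)) g *
          (∑ i, c t₀ i * b i (g : Matrix (Fin N) (Fin N) ℂ)) -
          Gam (fun Q => ∑ i, c t₀ i * b i Q) (fun Q => ∑ i, c t₀ i * b i Q) g *
            Lap (fun Q => ∑ i, c t₀ i * b i Q) g) /
        (∑ i, c t₀ i * b i (g : Matrix (Fin N) (Fin N) ℂ)) ^ 2 ∂(haarSU N) =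
      ∫ g : SUN N, (2 * Gx t₀ g * P t₀ g - G t₀ g * LP t₀ g) / (P t₀ g) ^ 2 ∂(haarSU N) := by
    refine integral_congr_ae (ae_of_all _ fun g => ?_)
    dsimp only
    rw [hheat t₀, hGamL t₀ g, hGam t₀ g]
  rw [eF, eV]
  exact hmain

/-- ★ **`I'(t₀) ≤ −N·I(p_{t₀})`** along a positive polynomial heat flow: the differential form of the exponential decay
of the Fisher information `I(P_t f) ≤ e^{−2ρt} I(f)`, `ρ = N/2` (BGL (5.7.2)/(5.7.4)), obtained from
`hasDerivAt_fisher_flow` and the integrated `Γ₂` inequality `integral_fisherDeriv_le`.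
[cite: BakryGentilLedoux2014, §5.7 (5.7.4) (p. 269)] -/
theorem hasDerivAt_fisher_flow_le (hN : N ≠ 0) {d : ℕ} {b : Fin d → Matrix (Fin N) (Fin N) ℂ → ℝ}
    (hb : ∀ i, ContDiff ℝ ∞ (b i)) {c c' : ℝ → Fin d → ℝ} (hc : ∀ t i, HasDerivAt (fun s => c s i) (c' t i) t)
    (hc' : ∀ i, Continuous fun t => c' t i)
    (hheat : ∀ t, Lap (fun Q => ∑ i, c t i * b i Q) = fun Q => ∑ i, c' t i * b i Q)
    {δ t₀ ε : ℝ} (hδ : 0 < δ) (hε : 0 < ε)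
    (hpos : ∀ t ∈ Icc (t₀ - ε) (t₀ + ε), ∀ g : SUN N, δ ≤ ∑ i, c t i * b i (g : Matrix (Fin N) (Fin N) ℂ)) :
    ∃ D : ℝ, HasDerivAt (fun t => ∫ g : SUN N, Gam (fun Q => ∑ i, c t i * b i Q) (fun Q => ∑ i, c t i * b i Q) g /
        (∑ i, c t i * b i (g : Matrix (Fin N) (Fin N) ℂ)) ∂(haarSU N)) D t₀ ∧
      D ≤ -(N : ℝ) * ∫ g : SUN N, Gam (fun Q => ∑ i, c t₀ i * b i Q) (fun Q => ∑ i, c t₀ i * b i Q) g /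
        (∑ i, c t₀ i * b i (g : Matrix (Fin N) (Fin N) ℂ)) ∂(haarSU N) := by
  refine ⟨_, hasDerivAt_fisher_flow hb hc hc' hheat hδ hε hpos, ?_⟩
  have ht₀ : t₀ ∈ Icc (t₀ - ε) (t₀ + ε) := ⟨by linarith, by linarith⟩
  exact integral_fisherDeriv_le hN (contDiff_sum_mul hb (c t₀)) hδ (fun g => hpos t₀ ht₀ g)

end SUNBakryEmery

end Literature.MathematicalPhysics.QuantumFieldTheory
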